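import Mathlib
import Summits.Ventures.PercRepro2.LocRows
import Summits.Ventures.PercRepro2.SwRow
import Summits.Ventures.PercRepro2.SwOut
import Summits.Ventures.PercRepro2.SwAllRow
import Summits.Ventures.PercRepro2.SwOutAll
import Summits.Ventures.PercRepro2.SwOutArmFlip
import Summits.Ventures.PercRepro2.SwOutArms
import Summits.Ventures.PercRepro2.SwOutArmOrbit
import Summits.Ventures.PercRepro2.SwOutArmCube
import Summits.Ventures.PercRepro2.SwOutArmThm
import Summits.Ventures.PercRepro2.SwOutCoreDefs
import Summits.Ventures.PercRepro2.SwOutCoreHull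
import Summits.Ventures.PercRepro2.SwOutCoreDual
import Summits.Ventures.PercRepro2.SwOutCoreKey
import Summits.Ventures.PercRepro2.SwOutCoreShadowUnion
import Summits.Ventures.PercRepro2.SwOutJunctionH1Defs
import Summits.Ventures.PercRepro2.SwOutJunctionH1Arms
import Summits.Ventures.PercRepro2.SwOutJunctionH1Cover
import Summits.Ventures.PercRepro2.SwOutJunctionH1Inside
import Summits.Ventures.PercRepro2.SwOutJunctionH1Base
import Summits.Ventures.PercRepro2.SwOutJunctionH1Kinds
import Summits.Ventures.PercRepro2.SwOutMixedPartDefs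
import Summits.Ventures.PercRepro2.SwOutMixedPartCore
import Summits.Ventures.PercRepro2.SwOutMixedPartOrbitDefs

/-!
# The coarse orbits of a core cube without pure arms stay in the cube (blind cell PercRepro2,
night-4 g19, 2026-08-27; proofs/NIGHT4-G19.md §5 (iii))

For a core base without pure arms (every arm an h-arm) whose arms are connected, the flip of a
union of coarse arms at a cube point is again a cube point (`flip_armClosed_eq_coreReal`: the
arms inside the union toggled — the analogue of `flip_armClosed_eq_mixedReal`), so every point of
the coarse orbit of a core-free cube point is a cube point (`exists_coreReal_of_mem_orbit`).
Hence the core cube of a core-kind point with a RED dead edge (`coreBase_of_coreKind_mix`, the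
(C-red) half of the dichotomy) absorbs the whole coarse orbit of any of its core-free points:
every such orbit point is of the core kind (**`coreKind_of_mem_orbit_red`**) — no escaping point
lies in the orbit of a (C-red) core point.  Also `armC_conn`: the arms of a configuration are
connected inside themselves.
-/

namespace Summit.Ventures.PercRepro2

namespace BigBlock

open Hull LocRows

variable {V : Type*} {E : Type*} [Fintype E] [DecidableEq E]

open scoped Classical

section CoreOrbit

variable {ι : Type*} {ends : E → Sym2 V} {ζ : Config E} {h u : V} {H : Set V} {A : ι → Set V}
  {pure : ι → Prop} (hb : CoreBase ends ζ h u H A pure)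
include hb

omit [Fintype E] [DecidableEq E] in
/-- Every arm vertex lies in the hull of `h` at a cube point (no pure arms). -/
lemma CoreBase.arm_subset_hull_coreReal (hnp : ∀ i, ¬ pure i) (ω : Config ι) {i : ι} {x : V}
    (hx : x ∈ A i) : x ∈ hull ends (coreReal ends A ζ ω) h := by
  cases hi : ω i with
  | true =>
    left
    rw [hb.cluster_coreReal, mem_redSet_iff]
    exact Or.inr (Or.inl ⟨i, hi, hnp i, hx⟩)
  | false =>
    right
    rw [hb.cluster_blue_coreReal, mem_redSet_iff]
    refine Or.inr (Or.inl ⟨i, ?_, hnp i, hx⟩)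
    simp only [flipAll, hi, Bool.not_false]

omit [Fintype E] [DecidableEq E] in
/-- The other end of an edge with an end in an arm: in the arm, at `h`, at `u`, or outside `H`. -/
lemma CoreBase.end_of_arm_edge {i : ι} {e : E} {x y : V} (hxy : ends e = s(x, y)) (hx : x ∈ A i) :
    y ∈ A i ∨ y = h ∨ y = u ∨ y ∉ H := by
  by_cases hyH : y ∈ H
  · by_cases hyh : y = h
    · exact Or.inr (Or.inl hyh)
    by_cases hyu : y = u
    · exact Or.inr (Or.inr (Or.inl hyu))
    obtain ⟨j, hj⟩ := hb.arm_cover y hyH hyh hyu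
    by_cases hij : i = j
    · rw [hij]; exact Or.inl hj
    · exact absurd (hb.no_cross i j hij e x y hxy hx hj) id
  · exact Or.inr (Or.inr (Or.inr hyH))

omit [Fintype E] [DecidableEq E] in
/-- **The flip of a union of coarse arms at a cube point is a cube point** (no pure arms, the
arms connected): the arms inside the union toggled. -/
theorem CoreBase.flip_armClosed_eq_coreReal (hnp : ∀ i, ¬ pure i)
    (hconn : ∀ i, ∀ x ∈ A i, ∀ y ∈ A i, y ∈ cluster ends (fun e => decide (e ∈ within ends (A i))) x)
    (ω : Config ι) {W : Set V} (hW : ArmClosed ends (coreReal ends A ζ ω) h W) :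
    flip ends W (coreReal ends A ζ ω) =
      coreReal ends A ζ (fun i => if A i ⊆ W then !ω i else ω i) := by
  have hhW : h ∉ W := fun hh => (hW.subset h hh).2 rfl
  have hsub : ∀ i, A i ⊆ W ∨ ∀ x ∈ A i, x ∉ W := fun i =>
    subset_or_disjoint_of_armClosed hW
      (fun x hx => ⟨CoreBase.arm_subset_hull_coreReal hb hnp ω hx, fun h' => hb.h_notMem_arm i (h' ▸ hx)⟩)
      (hconn i)
  funext e
  by_cases he : e ∈ touches ends (allArms A)
  · obtain ⟨i, x, y, hxy, hx⟩ := CoreBase.exists_arm_of_touches_allArms he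
    have hmem : e ∈ touches ends W ↔ A i ⊆ W := by
      constructor
      · rintro ⟨z, hzW, w, hzw⟩
        rcases hsub i with hsub | hdisj
        · exact hsub
        exfalso
        have hz : z = x ∨ z = y := by
          rw [hxy, Sym2.eq_iff] at hzw
          rcases hzw with ⟨h1, _⟩ | ⟨_, h2⟩
          · exact Or.inl h1.symm
          · exact Or.inr h2.symm
        rcases hz with rfl | rfl
        · exact hdisj z hx hzW
        · rcases CoreBase.end_of_arm_edge hb hxy hx with hy | rfl | rfl | hyH
          · exact hdisj z hy hzW
          · exact hhW hzW
          · exact hdisj x hx (hW.closed e z x (ends_swap hxy) hzW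
              (CoreBase.arm_subset_hull_coreReal hb hnp ω hx) (fun h' => hb.h_notMem_arm i (h' ▸ hx)))
          · exact hyH (hb.hull_coreReal_subset ω (hW.subset z hzW).1)
      · intro hsub
        exact ⟨x, hsub hx, y, hxy⟩
    by_cases hAi : A i ⊆ W
    · rw [flip_apply_of_mem (hmem.2 hAi), hb.coreReal_apply_of_mem hxy hx,
        hb.coreReal_apply_of_mem hxy hx, if_pos hAi]
      cases ω i <;> simp
    · rw [flip_apply_of_notMem (fun h' => hAi (hmem.1 h')), hb.coreReal_apply_of_mem hxy hx,
        hb.coreReal_apply_of_mem hxy hx, if_neg hAi]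
  · have hnot : e ∉ touches ends W := by
      rintro ⟨z, hzW, w, hzw⟩
      have hzH := hb.hull_coreReal_subset ω (hW.subset z hzW).1
      have hzh := (hW.subset z hzW).2
      by_cases hzu : z = u
      · rw [hzu] at hzw
        obtain ⟨i, hi⟩ := hb.u_edges e w hzw
        exact he ⟨w, ⟨i, hi⟩, u, ends_swap hzw⟩
      · obtain ⟨i, hi⟩ := hb.arm_cover z hzH hzh hzu
        exact he ⟨z, ⟨i, hi⟩, w, hzw⟩
    rw [flip_apply_of_notMem hnot, CoreBase.coreReal_apply_of_notMem he,
      CoreBase.coreReal_apply_of_notMem he]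

/-- **Every point of the coarse orbit of a core-free cube point is a cube point** (no pure arms,
the arms connected). -/
theorem CoreBase.exists_coreReal_of_mem_orbit (hnp : ∀ i, ¬ pure i)
    (hconn : ∀ i, ∀ x ∈ A i, ∀ y ∈ A i, y ∈ cluster ends (fun e => decide (e ∈ within ends (A i))) x)
    (ω : Config ι) (hc : CoreFree ends (coreReal ends A ζ ω) h) {ζ'' : Config E}
    (hζ'' : ζ'' ∈ orbit ends (allRed ends (coreReal ends A ζ ω) h) h) :
    ∃ ω' : Config ι, ζ'' = coreReal ends A ζ ω' := by
  obtain ⟨P, hP⟩ := exists_armsUnion_of_mem_orbit hc hζ''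
  exact ⟨_, hP.trans (CoreBase.flip_armClosed_eq_coreReal hb hnp hconn ω (armClosed_armsUnion P))⟩

end CoreOrbit

section Concrete

variable {ends : E → Sym2 V} {U : Set V} {ξ : Config E} {l h o u p : V}

omit [Fintype E] [DecidableEq E] in
/-- The cluster of a vertex inside a set, in the graph restricted to the set, stays in the set. -/
lemma cluster_within_subset {S : Set V} {x : V} (hx : x ∈ S) :
    cluster ends (fun e => decide (e ∈ within ends S)) x ⊆ S := by
  intro y hy
  refine mem_of_conn_of_closed (ends := ends) (ω := fun e => decide (e ∈ within ends S)) ?_ hx hy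
  intro a _ b hab
  obtain ⟨_, e, he, hends⟩ := openGraph_adj.1 hab
  have hin : e ∈ within ends S := by simpa using he
  obtain ⟨a', ha', b', hb', hab'⟩ := hin
  rw [hends, Sym2.eq_iff] at hab'
  rcases hab' with ⟨_, h2⟩ | ⟨_, h2⟩
  · rw [h2]; exact hb'
  · rw [h2]; exact ha'

omit [Fintype E] [DecidableEq E] in
/-- **The arms of a configuration are connected inside themselves.** -/
theorem armC_conn (ζ : Config E) (z : V) :
    ∀ x ∈ armC ends h u ζ z, ∀ y ∈ armC ends h u ζ z,
      y ∈ cluster ends (fun e => decide (e ∈ within ends (armC ends h u ζ z))) x := by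
  intro x hx y hy
  have hxy : Conn ends (armConfigC ends h u ζ) x y := conn_trans (conn_symm hx) hy
  refine mem_of_conn_of_closed (ends := ends) (ω := armConfigC ends h u ζ) ?_
    (mem_cluster_self _ _ _) hxy
  intro a ha b hab
  obtain ⟨_, e, he, hends⟩ := openGraph_adj.1 hab
  have haA : a ∈ armC ends h u ζ z := cluster_within_subset hx ha
  have hbA : b ∈ armC ends h u ζ z := mem_cluster_of_edge haA he hends
  have hin : (fun e => decide (e ∈ within ends (armC ends h u ζ z))) e = true := by
    simp only [decide_eq_true_eq]
    exact ⟨a, haA, b, hbA, hends⟩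
  exact mem_cluster_of_edge ha hin hends

variable (hj : MixedJunction ends U h u p o)
include hj

/-- **No escaping point lies in the coarse orbit of a core-kind point with a red dead edge**:
every point of the orbit of such a core-free point is of the core kind. -/
theorem coreKind_of_mem_orbit_red (hl : l ∉ U) {ζ : Config E}
    (hζ : ζ ∈ swOutSide ends l h o U ξ) (hk : CoreKind ends U h u ζ)
    (hred : ∃ e x, ends e = s(p, x) ∧ x ∈ AhOf ends h u p ζ ∧ coreBaseOf ends ζ h u e = true)
    (hc : CoreFree ends ζ h) {ζ'' : Config E} (hζ'' : ζ'' ∈ orbit ends (allRed ends ζ h) h) :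
    CoreKind ends U h u ζ'' := by
  have hb := coreBase_of_coreKind_mix hj hl hζ hk hred
  have hHU : extHull ends ζ h u ⊆ U := extHull_subset_of_coreKind hζ hk
  have hnp : ∀ P : armsC ends h u ζ, ¬ pureC ends h P.1 := by
    intro P hpure
    obtain ⟨e, y, hey, hyP⟩ := armsC_not_pure hj hHU P.2
    exact hpure e y hey hyP
  have hconn : ∀ P : armsC ends h u ζ, ∀ x ∈ P.1, ∀ y ∈ P.1,
      y ∈ cluster ends (fun e => decide (e ∈ within ends P.1)) x := by
    intro P
    obtain ⟨z, _, _, _, hPz⟩ := exists_of_mem_armsC P.2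
    have : P.1 = armC ends h u ζ z := hPz
    rw [this]
    exact armC_conn ζ z
  have hζeq := coreReal_coreBaseOf hl hj.hne_hu hj.hout hζ hk
  rw [← hζeq] at hc hζ''
  obtain ⟨ω', hω'⟩ := CoreBase.exists_coreReal_of_mem_orbit hb hnp hconn _ hc hζ''
  rw [hω']
  exact ⟨hb.u_mem_hull_coreReal ω', (hb.hull_u_coreReal_subset ω').trans hHU⟩

end Concrete

end BigBlock

end Summit.Ventures.PercRepro2
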